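import Summits.ResolutionOfSingularities.ResolutionOfSingularities.Theorems.DeltaCutStellarJetStar
import Summits.ResolutionOfSingularities.ResolutionOfSingularities.Theorems.DeltaCutStellarWildCarve

/-!
# δ-cut, stellar NC-HYP arm — «JetCut» §Law: THE NARROW WILD LAW ON THE JET CELL and the exact carving of `WORNCHypWildRest` (T19c)

[OURS · decomp-res-lens-6 g35 · lens «barrier-complement carving» · column item `E1TopNoAbs` (stmt-ResolutionOfSingularities-26971)
· critic ROW 241 / WINDOW g35 (a)]

THE CARVING OF THE NARROW WILD CELL (T18 `WORNCHypWildRest n`: `p ∣ n` and NOT a coprime-labelled frame at `p = n`):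
* `IsNCHypStageJet p n N` — an s.n.c. hypersurface-shape frame with `SuppLE` carrying THE JET CLAUSE (`NCFrame.JetClause p`: at
  every `p`-divisible point of `H` a jet datum, T19b `JetAt`) — DEFINITION; `IsNCHypStageCop p n N → IsNCHypStageJet p n N`
  (`isNCHypStageJet_of_cop`: a coprime-labelled frame has no `p`-divisible point) — the jet cell CONTAINS the wide wild cell.
* `WORNCHypWildJet n` — THE JET CELL: the binders of `WORNCHypWild n` verbatim at the pure-characteristic marking `p = n` for jet
  frames.  ★★ DECIDED · HOLDS: `worNCHypWildJet_holds (n) (1 ≤ n)` — bridge `exists_ncHypShapeJet_of_isNCHypStageJet` + T19b's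
  strategy law `exists_weakResolution_of_ncHypShapeJet`.  T18's `worNCHypWildCop_holds` is now a COROLLARY (`worNCHypWildCop_of_jet`).
* `WORNCHypWildRest2 n` — THE REMAINDER (exact complement of the jet cell inside the wild cell): `p ∣ n` and NOT (`p = n` with a
  jet frame).  UNDECIDED · TYPED WITH TEST DATA: (i) `p = n = 2`, `H = (x)`, labels `(2,2)` on `(z, w)`: Hauser's kangaroo
  `x² + (1 + xz)·z²w²` and `x² + (1 + x)·z²w²` over `𝔽₂` — hypersurface-shape s.n.c. frames with NO jet datum at the origin (every
  frame-logarithmic derivation of `𝔽₂[x,z,w]_{(x,z,w)}` maps `1 + xz`, `1 + x` into `𝔪`, and in any presentation `hᵖ + r·m₀ᵖ` of the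
  equation `δ r ∈ 𝔪`), on which T16's strategy LEAVES `V(H')` (rounds 1 and 2 respectively) — another strategy is needed
  [cite: Hauser2010, §§3–5]; (ii) `n = p·m`, `m ≥ 2`: `n = 4`, `p = 2`, labels `(3,3)` ↦ new label `2` ↦ `(2,2)` (g34 data).
* EXACT CARVES: `worNCHypWild_iff_jet_rest2 : WORNCHypWild n ↔ WORNCHypWildJet n ∧ WORNCHypWildRest2 n` (hyp-free) and, the jet law
  being proved, `worNCHypWildRest_iff_rest2 : WORNCHypWildRest n ↔ WORNCHypWildRest2 n`, `worNCHypWild_iff_rest2`; families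
  `E1NCHypWildJet` (HOLDS), `E1NCHypWildRest2`, `e1NCHypWildRest_iff_rest2`; the column's §Carve edges re-pointed at the remainder:
  `E1TopSHeavy ⟸ E1NCHypWildRest2 ∧ E1NCEntryPerpetual ∧ E1TopSFrozenOffNC` (`e1TopSHeavy_of_wildRest2`), … , `e_one_of_wildRest2`.

HONEST SCOPE.  `WORNCHypWildRest2 n` is UNDECIDED · IDEA-NEEDED (both test families above; desk reason: at the kangaroo origin
every frame-logarithmic derivation has `δu ∈ 𝔪`, and the clean datum `x² + (1+z)·z²w²` in its ORIGINAL frame `(V(x); z:2, w:2)`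
is not jet-certified either — the class sees it only REFRAMED as `(x+zw)² + z³w²`, frame `(V(x+zw); z:3, w:2)`, kernel inhabitant
in `DeltaCutStellarJetInhabitant`).  Content exactly at PRIME levels `n = p` (composite `n`: `WORNCHypWildJet n` vacuous, as T18's
Cop cell); `dim Y ≤ 4` unused; no residue-field / perfectness hypothesis; no claim about Cossart–Piltant 2019.  Column residual
after this file: `E1TopSHeavy ⟸ E1NCHypWildRest2 ∧ E1NCEntryPerpetual ∧ E1TopSFrozenOffNC` (`e1TopSHeavy_of_wildRest2`); the window
items (b) `SPerpetual 2 ⟨D₀, none⟩` and (c) ENTRY are NOT touched by this node; the cell-level (`IsBase`/`IsDatum`/`IsNCHypStageJet`)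
inhabitant of the law's binders stays owed (hygiene debt (d)).

0 sorry; axioms standard. [new] [cite: Hauser2010, §§3–5] [cite: Kollar2007, (3.111) Step 3] [cite: CossartPiltant2008, Prop. 4.2 (a)]
-/

noncomputable section

open CategoryTheory CategoryTheory.Limits AlgebraicGeometry TopologicalSpace IsLocalRing
open Literature.AlgebraicGeometry.Resolution

namespace Summit.ResolutionOfSingularities.ResolutionOfSingularities.Theorems.DeltaCutClasses

open Summit.ResolutionOfSingularities.ResolutionOfSingularities.Theorems
open WeakOrderReduction ForcedTowerClasses

/-! ### §Cells — the jet cell and the remainder -/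

section Cells

open AlgebraicGeometry.Scheme.IdealSheafData (vanishingIdeal)

/-- **`F.JetClause p` — THE JET CLAUSE of an n.c. frame** on the stage `N = (Y, 𝓘)`: at every `p`-DIVISIBLE point `y ∈ H` of the
labelled boundary `(𝓘(H), 0) :: [(𝓘(Dᵢ), aᵢ)]ᵢ` (every `Dᵢ ∋ y` has `p ∣ aᵢ`, one of them `aᵢ ≠ 0`) there is a JET DATUM for `𝓘`
(T19b `JetAt`: `h, m₀, r ∈ 𝒪_y`, a derivation `δ` of `𝒪_y` logarithmic for `H` and the `Dᵢ` through `y`, `𝓘(H)_y = (h)`,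
`m₀ᵖ ∈ 𝓜_y`, `hᵖ + r·m₀ᵖ ∈ 𝓘_y`, `δ r` a unit). DEFINITION (letter · the «JetCut» certificate). -/
def NCFrame.JetClause (p : ℕ) {N : Stage} (F : NCFrame N) : Prop :=
  ∀ y : N.Y, y ∈ (F.H : Set N.Y) → DivPt p ((vanishingIdeal F.H, 0) :: F.expList) y →
    JetAt p ((vanishingIdeal F.H, 0) :: F.expList) (vanishingIdeal F.H) N.I y

/-- **`IsNCHypStageJet p n N` — JET-CERTIFIED hypersurface-shape n.c. stage**: an s.n.c. frame in the hypersurface shape with `SuppLE`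
(`IsNCHypStage n N`) satisfying the jet clause at `p`. DEFINITION (letter · the jet class). -/
def IsNCHypStageJet (p n : ℕ) (N : Stage) : Prop :=
  ∃ F : NCFrame N, F.IsSNC ∧ F.HypShape n ∧ F.SuppLE n ∧ F.JetClause p

/-- a jet-certified stage is a hypersurface-shape n.c. stage -/
theorem isNCHypStage_of_jet {p n : ℕ} {N : Stage} (h : IsNCHypStageJet p n N) : IsNCHypStage n N := by
  obtain ⟨F, hS, hF, hSupp, -⟩ := h
  exact ⟨F, hS, hF, hSupp⟩

/-- the components of an s.n.c. frame have pairwise distinct ideal sheaves. [folklore] -/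
theorem NCFrame.eq_of_vanishingIdeal_eq {N : Stage} {F : NCFrame N} (hS : F.IsSNC) (i j : Fin F.r)
    (hij : vanishingIdeal (F.D i) = vanishingIdeal (F.D j)) : i = j := by
  by_contra hne
  have hset : ((F.D i : Closeds N.Y) : Set N.Y) = (F.D j : Set N.Y) := by
    rw [← Scheme.IdealSheafData.coe_support_vanishingIdeal (Z := F.D i), hij,
      Scheme.IdealSheafData.coe_support_vanishingIdeal]
  exact hS.2.2.2.2.2 i j hne hset.le

/-- **the wide wild class lies in the jet class**: a COPRIME-LABELLED s.n.c. frame has no `p`-divisible point, so its jet clause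
is vacuous. [new] -/
theorem isNCHypStageJet_of_cop {p n : ℕ} {N : Stage} (h : IsNCHypStageCop p n N) : IsNCHypStageJet p n N := by
  obtain ⟨F, hS, hF, hSupp, hlab⟩ := h
  refine ⟨F, hS, hF, hSupp, fun y _ hD => ?_⟩
  obtain ⟨hdiv, K, hyK, hK0⟩ := hD
  rcases F.expOf_cons_expList (NCFrame.eq_of_vanishingIdeal_eq hS) K with h0 | ⟨i, hi⟩
  · exact absurd h0 hK0
  · have h := hdiv K hyK
    rw [hi] at h hK0
    exact absurd h ((hlab i).resolve_left hK0)

/-- **`WORNCHypWildJet n` — THE JET CELL**: the binders of `WORNCHypWild n` (T8) verbatim, at the PURE-CHARACTERISTIC marking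
`p = n`, for JET-CERTIFIED frames.  DECIDED · HOLDS (`worNCHypWildJet_holds`).  Inhabited non-degenerately: the clean frame
`(x + zw)² + z³w²` on `Spec 𝔽₂[x,z,w]_{(x,z,w)}` (T19d, list level); contains the whole wide wild cell (`isNCHypStageJet_of_cop`). -/
def WORNCHypWildJet (n : ℕ) : Prop :=
  ∀ p : ℕ, p.Prime → ∀ (k : Type) [Field k] [CharP k p] (Y : Scheme.{0}) (g : Y ⟶ Spec (.of k)),
    IsBase Y g → p = n → ∀ M : MarkedIdeal Y, IsDatum n M → IsNCHypStageJet p n ⟨Y, M.ideal⟩ →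
      ∃ t : CentreSeq Y, WeakResolution t M

/-- **`WORNCHypWildRest2 n` — THE REMAINDER OF THE NARROW WILD CELL** (exact complement of the jet cell inside `WORNCHypWild n`):
`p ∣ n` and NOT (`p = n` with a jet-certified frame).  UNDECIDED · TYPED WITH TEST DATA (module docstring): at `p = n = 2` the
kangaroo frames `x² + (1 + xz)·z²w²`, `x² + (1 + x)·z²w²` over `𝔽₂` (labels `(2,2)`, no jet datum at the origin, T16's strategy
leaves `V(H')`); at `n = p·m`, `m ≥ 2`, the label datum `n = 4`, `p = 2`, `(3,3) ↦ 2 ↦ (2,2)`. [cite: Hauser2010, §§3–5] -/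
def WORNCHypWildRest2 (n : ℕ) : Prop :=
  ∀ p : ℕ, p.Prime → ∀ (k : Type) [Field k] [CharP k p] (Y : Scheme.{0}) (g : Y ⟶ Spec (.of k)),
    IsBase Y g → p ∣ n → ∀ M : MarkedIdeal Y, IsDatum n M → IsNCHypStage n ⟨Y, M.ideal⟩ →
      ¬ (p = n ∧ IsNCHypStageJet p n ⟨Y, M.ideal⟩) → ∃ t : CentreSeq Y, WeakResolution t M

/-- ★ **THE CARVE OF THE WILD CELL BY THE JET CLASS (exact, hyp-free)**: `WORNCHypWild n ⟺ WORNCHypWildJet n ∧ WORNCHypWildRest2 n`.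
[new] -/
theorem worNCHypWild_iff_jet_rest2 (n : ℕ) : WORNCHypWild n ↔ WORNCHypWildJet n ∧ WORNCHypWildRest2 n := by
  constructor
  · intro h
    exact ⟨fun p hp k _ _ Y g hB hpn M hM hS =>
        h p hp k Y g hB (Dvd.intro 1 (by rw [mul_one, hpn])) M hM (isNCHypStage_of_jet hS),
      fun p hp k _ _ Y g hB hd M hM hS _ => h p hp k Y g hB hd M hM hS⟩
  · rintro ⟨hJ, hR⟩ p hp k _ _ Y g hB hd M hM hS
    by_cases hc : p = n ∧ IsNCHypStageJet p n ⟨Y, M.ideal⟩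
    · exact hJ p hp k Y g hB hc.1 M hM hc.2
    · exact hR p hp k Y g hB hd M hM hS hc

/-- the remainder is a SUB-CELL of the narrow wild cell: `WORNCHypWildRest n → WORNCHypWildRest2 n` (the jet class contains the
coprime class). [new] -/
theorem worNCHypWildRest2_of_rest {n : ℕ} (hR : WORNCHypWildRest n) : WORNCHypWildRest2 n :=
  fun p hp k _ _ Y g hB hd M hM hS hc =>
    hR p hp k Y g hB hd M hM hS fun h => hc ⟨h.1, isNCHypStageJet_of_cop h.2⟩

/-- the FAMILY of jet cells (all markings `n ≥ 1`) -/
def E1NCHypWildJet : Prop := ∀ n : ℕ, 1 ≤ n → WORNCHypWildJet n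

/-- the FAMILY of remainders (all markings `n ≥ 1`): the column's LOCATED RESIDUAL after g35 (was `E1NCHypWildRest`, T18).
UNDECIDED · typed with test data. -/
def E1NCHypWildRest2 : Prop := ∀ n : ℕ, 1 ≤ n → WORNCHypWildRest2 n

end Cells

/-! ### §Law — the bridge from the binders and the jet law -/

section Law

open AlgebraicGeometry.Scheme.IdealSheafData (vanishingIdeal)

variable {Y : Scheme.{0}}

/-- **THE BRIDGE from the binders of `WORNCHypWildJet`**: a base `p`-datum over a field of characteristic `p` whose stage is a
JET-CERTIFIED hypersurface-shape n.c. stage is a `ncHypShapeJet p`-datum for `E := (𝓘(H), 0) :: [(𝓘(Dᵢ), aᵢ)]ᵢ`, `H := 𝓘(F.H)`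
(T17b's unit-free bridge; `p = 0` in the stalks; the frame's jet clause IS the list-level jet clause). [new] [folklore] -/
theorem exists_ncHypShapeJet_of_isNCHypStageJet {p : ℕ} (hp : p.Prime) {k : Type} [Field k] [CharP k p]
    (g : Y ⟶ Spec (.of k)) (hB : IsBase Y g) {M : MarkedIdeal Y} (hM : IsDatum p M)
    (hNC : IsNCHypStageJet p p ⟨Y, M.ideal⟩) :
    ∃ (E : List (Y.IdealSheafData × ℕ)) (H : Y.IdealSheafData),
      HasSNC (H :: boundaryOf E) ∧ H ∈ boundaryOf E ∧ ncHypShapeJet p Y E H M := by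
  obtain ⟨F, hS, hF, hSupp, hJ⟩ := hNC
  obtain ⟨hH, hEs, hP⟩ := ncHypShapeF_of_isBase g hB hM hS hF hSupp
  exact ⟨_, _, hEs, hH, hP, hp, natCast_stalk_eq_zero_of_charP p g, fun y hy hD =>
    hJ y (mem_support_vanishingIdeal_iff.mp hy) hD⟩

/-- ★★ **THE JET LAW HOLDS** — `WORNCHypWildJet n` for every `n ≥ 1`: at the pure-characteristic marking `p = n`, a base `n`-datum
whose stage is a JET-CERTIFIED s.n.c. hypersurface-shape stage admits a weak resolution — by the strategy through `H` (T16) on the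
jet shape: the guard by the near-point / dull lemmas on unsafe faces (T19b-iii), the jet clause transported along the star phases
(T19b-ii/iii).  The cell `WORNCHypWildJet` of the carving `worNCHypWild_iff_jet_rest2` is DECIDED · HOLDS; `WORNCHypWildRest2`
stays UNDECIDED. [new] [cite: Hauser2010, §5] [cite: Kollar2007, (3.111) Step 3] [cite: CossartPiltant2008, Prop. 4.2 (a)] -/
theorem worNCHypWildJet_holds (n : ℕ) (_hn : 1 ≤ n) : WORNCHypWildJet n := by
  intro p hp k _ _ Y g hB hpn M hM hNC
  subst hpn
  haveI := hB.locallyOfFiniteType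
  haveI := hB.quasiCompact
  haveI : IsLocallyNoetherian Y := LocallyOfFiniteType.isLocallyNoetherian g
  obtain ⟨E, H, hEs, hH, hP⟩ := exists_ncHypShapeJet_of_isNCHypStageJet hp g hB hM hNC
  exact exists_weakResolution_of_ncHypShapeJet hEs hH M hP

/-- the FAMILY of jet laws `E1NCHypWildJet` holds. [new] -/
theorem e1NCHypWildJet_holds : E1NCHypWildJet := worNCHypWildJet_holds

-- the law, fully qualified, binders `n` / `1 ≤ n` only; composite levels are VACUOUS (`p = n` with `p` prime).
example : ∀ n : ℕ, 1 ≤ n → Summit.ResolutionOfSingularities.ResolutionOfSingularities.Theorems.DeltaCutClasses.WORNCHypWildJet n :=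
  worNCHypWildJet_holds

example : WORNCHypWildJet 4 := fun p hp _ _ _ _ _ _ h4 => absurd (h4 ▸ hp) (by decide)

/-- the jet law CONTAINS the wide wild law (T18): `WORNCHypWildJet n → WORNCHypWildCop n`. [new] -/
theorem worNCHypWildCop_of_jet {n : ℕ} (hJ : WORNCHypWildJet n) : WORNCHypWildCop n :=
  fun p hp k _ _ Y g hB hpn M hM hS => hJ p hp k Y g hB hpn M hM (isNCHypStageJet_of_cop hS)

-- T18's `worNCHypWildCop_holds`, re-derived from the jet law
example (n : ℕ) (hn : 1 ≤ n) : WORNCHypWildCop n := worNCHypWildCop_of_jet (worNCHypWildJet_holds n hn)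

/-- ★ **THE NARROW WILD CELL IS ITS REMAINDER (exact)**: `WORNCHypWildRest n ⟺ WORNCHypWildRest2 n` (the jet law discharges the jet
part; hyp-free). [new] -/
theorem worNCHypWildRest_iff_rest2 (n : ℕ) : WORNCHypWildRest n ↔ WORNCHypWildRest2 n := by
  refine ⟨worNCHypWildRest2_of_rest, fun hR p hp k _ _ Y g hB hd M hM hS hc => ?_⟩
  by_cases hj : p = n ∧ IsNCHypStageJet p n ⟨Y, M.ideal⟩
  · exact worNCHypWildJet_holds n (hj.1 ▸ hp.one_lt.le) p hp k Y g hB hj.1 M hM hj.2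
  · exact hR p hp k Y g hB hd M hM hS hj

/-- ★ per level, the wild cell reduces to the remainder: `WORNCHypWild n ⟺ WORNCHypWildRest2 n` (exact). [new] -/
theorem worNCHypWild_iff_rest2 (n : ℕ) : WORNCHypWild n ↔ WORNCHypWildRest2 n := by
  rw [worNCHypWild_iff_jet_rest2]
  exact ⟨fun h => h.2, fun h => ⟨fun p hp k _ _ Y g hB hpn M hM hS =>
    worNCHypWildJet_holds n (hpn ▸ hp.one_lt.le) p hp k Y g hB hpn M hM hS, h⟩⟩

/-- `WORNCHypWildRest2 n → WORNCHypWildRest n`. [new] -/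
theorem worNCHypWildRest_of_rest2 {n : ℕ} (hR : WORNCHypWildRest2 n) : WORNCHypWildRest n :=
  (worNCHypWildRest_iff_rest2 n).mpr hR

/-- `WORNCHypWildRest2 n → WORNCHypWild n`. [new] -/
theorem worNCHypWild_of_rest2 {n : ℕ} (hR : WORNCHypWildRest2 n) : WORNCHypWild n := (worNCHypWild_iff_rest2 n).mpr hR

/-- per level: `WORNCHypWildRest2 n → WORNCHyp n` (tame T14 + jet law). [new] -/
theorem worNCHyp_of_wildRest2 {n : ℕ} (hn : 1 ≤ n) (hR : WORNCHypWildRest2 n) : WORNCHyp n :=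
  worNCHyp_of_wild hn (worNCHypWild_of_rest2 hR)

/-- per level: the n.c.-regime part of the residual from the remainder alone, `WORNCHypWildRest2 n → WORTopSHeavyNC n`. [new] -/
theorem worTopSHeavyNC_of_wildRest2 {n : ℕ} (hn : 1 ≤ n) (hR : WORNCHypWildRest2 n) : WORTopSHeavyNC n :=
  worTopSHeavyNC_of_wild hn (worNCHypWild_of_rest2 hR)

/-- families: `E1NCHypWildRest ⟺ E1NCHypWildRest2` (exact). [new] -/
theorem e1NCHypWildRest_iff_rest2 : E1NCHypWildRest ↔ E1NCHypWildRest2 :=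
  ⟨fun h n hn => (worNCHypWildRest_iff_rest2 n).mp (h n hn), fun h n hn => (worNCHypWildRest_iff_rest2 n).mpr (h n hn)⟩

/-- families: `E1NCHypWild ⟺ E1NCHypWildRest2` (exact). [new] -/
theorem e1NCHypWild_iff_rest2 : E1NCHypWild ↔ E1NCHypWildRest2 :=
  ⟨fun h n hn => (worNCHypWild_iff_rest2 n).mp (h n hn), fun h n hn => (worNCHypWild_iff_rest2 n).mpr (h n hn)⟩

/-- families: `E1NCHypWildRest2 → E1NCHyp`. [new] -/
theorem e1NCHyp_of_wildRest2 (hR : E1NCHypWildRest2) : E1NCHyp := e1NCHyp_of_wild (e1NCHypWild_iff_rest2.mpr hR)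

end Law

/-! ### §Carve — the column's carve with the tame, the wide wild and the jet cells DISCHARGED -/

section Carve

open SubfieldContactClasses

/-- **THE CARVE AFTER `WORNC`, `WORNCHypTame`, `WORNCHypWildCop` AND `WORNCHypWildJet`**:
`E1NCHypWildRest2 → E1NCEntryPerpetual → E1TopSFrozenOffNC → E1TopSHeavy`. [new] -/
theorem e1TopSHeavy_of_wildRest2 (hR : E1NCHypWildRest2) (hE : E1NCEntryPerpetual) (hO : E1TopSFrozenOffNC) : E1TopSHeavy :=
  e1TopSHeavy_of_wild (e1NCHypWild_iff_rest2.mpr hR) hE hO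

/-- exact remainder form: `E1NCHypWildRest2 → E1TopSHeavyOffNC → E1TopSHeavy`. [new] -/
theorem e1TopSHeavy_of_wildRest2_offNC (hR : E1NCHypWildRest2) (hO : E1TopSHeavyOffNC) : E1TopSHeavy :=
  e1TopSHeavy_of_wild_offNC (e1NCHypWild_iff_rest2.mpr hR) hO

/-- edge to the live aside (item 27045): under `E 5`,
`E1NCHypWildRest2 → E1NCEntryPerpetual → E1TopSFrozenOffNC → E1TopGHeavy`. [new] -/
theorem e1TopGHeavy_of_wildRest2 (h5 : E 5) (hR : E1NCHypWildRest2) (hE : E1NCEntryPerpetual) (hO : E1TopSFrozenOffNC) :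
    E1TopGHeavy :=
  e1TopGHeavy_of_wild h5 (e1NCHypWild_iff_rest2.mpr hR) hE hO

/-- edge to the column item (26971): under `SubfieldContactAbs` and `E 5`,
`E1NCHypWildRest2 → E1NCEntryPerpetual → E1TopSFrozenOffNC → E1TopNoAbs`. [new] -/
theorem e1TopNoAbs_of_wildRest2 (hSC : SubfieldContactAbs) (h5 : E 5) (hR : E1NCHypWildRest2) (hE : E1NCEntryPerpetual)
    (hO : E1TopSFrozenOffNC) : E1TopNoAbs :=
  e1TopNoAbs_of_wild hSC h5 (e1NCHypWild_iff_rest2.mpr hR) hE hO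

/-- summit edge of the column: under `SubfieldContactAbs` and `E 5`,
`E1NCHypWildRest2 → E1NCEntryPerpetual → E1TopSFrozenOffNC → E 1`. [new] -/
theorem e_one_of_wildRest2 (hSC : SubfieldContactAbs) (h5 : E 5) (hR : E1NCHypWildRest2) (hE : E1NCEntryPerpetual)
    (hO : E1TopSFrozenOffNC) : E 1 :=
  e_one_of_wild hSC h5 (e1NCHypWild_iff_rest2.mpr hR) hE hO

end Carve

end Summit.ResolutionOfSingularities.ResolutionOfSingularities.Theorems.DeltaCutClasses

end
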